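import Literature.AlgebraicGeometry.Frobenioids.ArchimedeanQuasiIsotropicSplitMono
import Literature.AlgebraicGeometry.Frobenioids.ArchimedeanNotIsoSubanchorC
import Literature.AlgebraicGeometry.Frobenioids.ArchimedeanNotIsoSubanchorAngular
import HarnessLib

/-!
# Frobenioids II, Proposition 3.5 (iv) for `C` and `A` (`ArchFrd.Prop35iv_C`, `ArchFrd.Prop35iv_A`;
# FACT-LIST F-0866 / F-0865): PROVED over every NONEMPTY base whose split monomorphisms are invertible

Mochizuki, *The geometry of Frobenioids II: poly-Frobenioids*, Kyushu J. Math. **62** (2008) 401–460,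
§3, Proposition 3.5 (iv), kurims p. 34 [cite: MochizukiFrdII2008, Prop 3.5 (iv) p.34]: "`F` is not of
RC-iso-subanchor type" (`F = C, A` of Example 3.3 over a connected, totally epimorphic `D → D₀` of
RC-iso-subanchor type); proof pp. 35–36: an RC-iso-subanchor structure on `F` would produce a complex
isotropic RC-anchor, but "an anchor is never isotropic" ([FrdI] Rmk. 3.1.1 [cite: MochizukiFrdI2008, Rmk. 3.1.1]).

PROOF-ONLY companion (seat abc-iut-f-014, block F; no definitions). In the tree: `ArchFrd.prop35iv_C/_A
(hD : IsGraphConnected D) (hTE : IsTotallyEpimorphic D)` (abc-iut-L1, `ArchimedeanNotIsoSubanchorC/Angular.lean`)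
and the refutation of the universal closures at the EMPTY base (`ArchFrd.not_forall_prop35iv_C/_A`,
abc-iut-f-007, `ArchimedeanProp35ivEmptyBase.lean`). As for (ii) (`ArchimedeanQuasiIsotropicSplitMono.lean`),
the ONLY use of total epimorphicity is «isotropic objects are not anchors of `F[ℂ]`», through
`ArchFrd.isIso_or_isIso_of_fac_frobHom`; and the only use of connectedness is NONEMPTINESS. Hence:

* `not_isAnchor_complexPart_of_isotropic_of_splitMono` (and `A.…`) — over a base whose split
  monomorphisms are invertible, a complex object of `C` (resp. `A`) with naively isotropic region is not
  an anchor of `C[ℂ]` (resp. `A[ℂ]`);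
* **`prop35iv_C_of_splitMono`**, **`prop35iv_A_of_splitMono`** — Prop. 3.5 (iv) for `C` and `A` over
  EVERY nonempty base `D → D₀` whose split monomorphisms are invertible (⊋ connected + totally
  epimorphic: `prop35iv_C_and_A_of_isTotallyEpimorphic'`).

The matching NEGATIVE over a CONNECTED base with one non-invertible split monomorphism (the toy base `T`)
is `ArchimedeanProp35ivCounterexampleConnected.lean`. No statement of the paper is strengthened or weakened
(print assumes `D` totally epimorphic); this concerns the typed rows F-0865/F-0866 (instance forms under
the weakest sufficient hypothesis, R5). Nothing here bears on [IUTchIII] Cor. 3.12.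
-/

namespace Literature.AlgebraicGeometry.Frobenioids

open CategoryTheory

noncomputable section

universe v u

namespace ArchFrd

variable {D : Type u} [Category.{v} D] (π : D ⥤ D0)

/-- In a full subcategory, an arrow whose underlying arrow is an isomorphism is an isomorphism. [folklore] -/
private theorem isIso_of_isIso_hom_full {T : Type u} [Category.{v} T] {P : ObjectProperty T}
    {X Y : P.FullSubcategory} (f : X ⟶ Y) [IsIso f.hom] : IsIso f :=
  ⟨⟨ObjectProperty.homMk (inv f.hom), ObjectProperty.hom_ext _ (IsIso.hom_inv_id f.hom),
    ObjectProperty.hom_ext _ (IsIso.inv_hom_id f.hom)⟩⟩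

/-! ### `F = C` -/

/-- Irreducibility of the prime-degree Frobenius arrows inside `C[ℂ]`, over a base whose split
monomorphisms are invertible (adapted from `ArchFrd.isIrreducibleHom_frobHomC`).
[cite: MochizukiFrdII2008, Prop 3.5 (iv) p.34] -/
theorem isIrreducibleHom_frobHomC_of_splitMono (hD : ∀ ⦃a b : D⦄ (s : a ⟶ b), IsSplitMono s → IsIso s)
    (X : C π) (hc : RC.complexObjects (rcOf π) X) (hX : X.fst.IsNaivelyIsotropic) (p : ℕ+)
    (hp : (p : ℕ).Prime) : IsIrreducibleHom (frobHomC π X hc p) := by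
  refine ⟨fun hi => ?_, fun W β α h => ?_⟩
  · haveI := hi
    haveI : IsIso ((RC.complexObjects (rcOf π)).ι.map (frobHomC π X hc p)) := inferInstance
    exact not_isIso_frobHom π X p (fun h1 => hp.ne_one (by rw [h1]; rfl))
      (this : IsIso (frobHom π X p))
  · have h' : β.hom ≫ α.hom = frobHom π X p := congrArg (fun k => k.hom) h
    rcases isIso_or_isIso_of_fac_frobHom_of_splitMono π hD hX p hp β.hom α.hom h' with hα | hβ
    · haveI := hα; exact Or.inl (isIso_of_isIso_hom_full α)
    · haveI := hβ; exact Or.inr (isIso_of_isIso_hom_full β)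

/-- **A complex object of `C` with naively isotropic region is not an anchor of `C[ℂ]`**, over a base
whose split monomorphisms are invertible (adapted from `ArchFrd.not_isAnchor_complexPart_of_isotropic`).
[cite: MochizukiFrdII2008, Prop 3.5 (iv) p.34] -/
theorem not_isAnchor_complexPart_of_isotropic_of_splitMono
    (hD : ∀ ⦃a b : D⦄ (s : a ⟶ b), IsSplitMono s → IsIso s) (X : C π)
    (hc : RC.complexObjects (rcOf π) X) (hX : X.fst.IsNaivelyIsotropic) :
    ¬ IsAnchor (⟨X, hc⟩ : RC.ComplexPart (rcOf π)) := by
  intro hfin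
  let P : ℕ → ℕ+ := fun n => ⟨Nat.nth Nat.Prime n, (Nat.prime_nth_prime n).pos⟩
  have hP : ∀ n, ((P n : ℕ+) : ℕ).Prime := fun n => Nat.prime_nth_prime n
  let g : ℕ → Quotient (isIsomorphicSetoid (Under (⟨X, hc⟩ : RC.ComplexPart (rcOf π)))) :=
    fun n => Quotient.mk _ (Under.mk (frobHomC π X hc (P n)))
  have hg : Function.Injective g := by
    intro m n hmn
    obtain ⟨e⟩ := Quotient.exact hmn
    have hPmn : P m = P n := eq_of_under_iso π X hc (hP m) (hP n) e
    have : Nat.nth Nat.Prime m = Nat.nth Nat.Prime n := congrArg (fun k : ℕ+ => (k : ℕ)) hPmn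
    exact Nat.nth_injective Nat.infinite_setOf_prime this
  refine Set.infinite_of_injective_forall_mem hg (fun n => ?_) hfin
  exact ⟨Under.mk (frobHomC π X hc (P n)), isIrreducibleHom_frobHomC_of_splitMono π hD X hc hX (P n) (hP n), rfl⟩

/-- **Proposition 3.5 (iv) for `F = C` — PROVED over EVERY nonempty base `D → D₀` whose split
monomorphisms are invertible** (print's route: an RC-iso-subanchor structure on `C` gives a complex
isotropic RC-anchor; adapted from `ArchFrd.prop35iv_C`, whose uses of connectedness / total epimorphicity
are exactly nonemptiness / invertible split monomorphisms). [cite: MochizukiFrdII2008, Prop 3.5 (iv) p.34] -/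
theorem prop35iv_C_of_splitMono [Nonempty D] (hD : ∀ ⦃a b : D⦄ (s : a ⟶ b), IsSplitMono s → IsIso s) :
    Literature.AlgebraicGeometry.Frobenioids.ArchFrd.Prop35iv_C π := by
  intro _ hC
  obtain ⟨d₀⟩ := ‹Nonempty D›
  obtain ⟨_, _, _, ⟨B', ⟨hc', _⟩, _⟩, _⟩ := hC.isRCIsoSubanchor (unitObjOver π d₀)
  obtain ⟨B₂, G₂, f₂, ⟨B₃, ⟨hc₃, hanch₃⟩, ⟨g₂⟩⟩, hf₂⟩ := hC.isRCIsoSubanchor (unitObjOver π B'.snd)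
  have hB₂ : B₂.fst.IsNaivelyIsotropic :=
    isNaivelyIsotropic_of_monoMinimalQuotient π G₂ f₂ hf₂ (AngularRegion.isIsotropic_isotropicOfTip 1)
  have hB₃ : B₃.fst.IsNaivelyIsotropic := C0.isNaivelyIsotropic_of_hom g₂.fst hB₂
  exact not_isAnchor_complexPart_of_isotropic_of_splitMono π hD B₃ hc₃ hB₃ hanch₃

/-! ### `F = A` -/

namespace A

/-- Irreducibility of the prime-degree Frobenius arrows inside `A[ℂ]`, over a base whose split
monomorphisms are invertible (adapted from `ArchFrd.A.isIrreducibleHom_frobHomC`).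
[cite: MochizukiFrdII2008, Prop 3.5 (iv) p.34] -/
theorem isIrreducibleHom_frobHomC_of_splitMono (hD : ∀ ⦃a b : D⦄ (s : a ⟶ b), IsSplitMono s → IsIso s)
    (X : A π) (hc : RC.complexObjects (rcOf π) X) (hX : X.obj.fst.IsNaivelyIsotropic) (p : ℕ+)
    (hp : (p : ℕ).Prime) : IsIrreducibleHom (frobHomC π X hc p) := by
  refine ⟨fun hi => ?_, fun W β α h => ?_⟩
  · haveI := hi
    haveI : IsIso ((RC.complexObjects (rcOf π)).ι.map (frobHomC π X hc p)) := inferInstance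
    exact (isIrreducibleHom_frobHom_of_splitMono π hD X hX p hp).1 (this : IsIso (frobHom π X p))
  · have h' : β.hom ≫ α.hom = frobHom π X p := congrArg (fun k => k.hom) h
    rcases (isIrreducibleHom_frobHom_of_splitMono π hD X hX p hp).2 β.hom α.hom h' with hα | hβ
    · haveI := hα; exact Or.inl (isIso_of_isIso_hom_full α)
    · haveI := hβ; exact Or.inr (isIso_of_isIso_hom_full β)

/-- **A complex object of `A` with naively isotropic region is not an anchor of `A[ℂ]`**, over a base whose
split monomorphisms are invertible. [cite: MochizukiFrdII2008, Prop 3.5 (iv) p.34] -/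
theorem not_isAnchor_complexPart_of_isotropic_of_splitMono
    (hD : ∀ ⦃a b : D⦄ (s : a ⟶ b), IsSplitMono s → IsIso s) (X : A π)
    (hc : RC.complexObjects (rcOf π) X) (hX : X.obj.fst.IsNaivelyIsotropic) :
    ¬ IsAnchor (⟨X, hc⟩ : RC.ComplexPart (rcOf π)) := by
  intro hfin
  let P : ℕ → ℕ+ := fun n => ⟨Nat.nth Nat.Prime n, (Nat.prime_nth_prime n).pos⟩
  have hP : ∀ n, ((P n : ℕ+) : ℕ).Prime := fun n => Nat.prime_nth_prime n
  let g : ℕ → Quotient (isIsomorphicSetoid (Under (⟨X, hc⟩ : RC.ComplexPart (rcOf π)))) :=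
    fun n => Quotient.mk _ (Under.mk (frobHomC π X hc (P n)))
  have hg : Function.Injective g := by
    intro m n hmn
    obtain ⟨e⟩ := Quotient.exact hmn
    have hPmn : P m = P n := eq_of_under_iso π X hc (hP m) (hP n) e
    have : Nat.nth Nat.Prime m = Nat.nth Nat.Prime n := congrArg (fun k : ℕ+ => (k : ℕ)) hPmn
    exact Nat.nth_injective Nat.infinite_setOf_prime this
  refine Set.infinite_of_injective_forall_mem hg (fun n => ?_) hfin
  exact ⟨Under.mk (frobHomC π X hc (P n)), isIrreducibleHom_frobHomC_of_splitMono π hD X hc hX (P n) (hP n),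
    rfl⟩

end A

/-- **Proposition 3.5 (iv) for `F = A` — PROVED over EVERY nonempty base `D → D₀` whose split
monomorphisms are invertible** (adapted from `ArchFrd.A.prop35iv`). [cite: MochizukiFrdII2008, Prop 3.5 (iv) p.34] -/
theorem prop35iv_A_of_splitMono [Nonempty D] (hD : ∀ ⦃a b : D⦄ (s : a ⟶ b), IsSplitMono s → IsIso s) :
    Literature.AlgebraicGeometry.Frobenioids.ArchFrd.Prop35iv_A π := by
  intro _ hA
  obtain ⟨d₀⟩ := ‹Nonempty D›
  obtain ⟨_, _, _, ⟨B', ⟨hc', _⟩, _⟩, _⟩ := hA.isRCIsoSubanchor ⟨unitObjOver π d₀⟩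
  obtain ⟨B₂, G₂, f₂, ⟨B₃, ⟨hc₃, hanch₃⟩, ⟨g₂⟩⟩, hf₂⟩ := hA.isRCIsoSubanchor ⟨unitObjOver π B'.obj.snd⟩
  have hB₂ : B₂.obj.fst.IsNaivelyIsotropic :=
    A.isNaivelyIsotropic_of_monoMinimalQuotient π G₂ f₂ hf₂ (AngularRegion.isIsotropic_isotropicOfTip 1)
  have hB₃ : B₃.obj.fst.IsNaivelyIsotropic := C0.isNaivelyIsotropic_of_hom g₂.1.fst hB₂
  exact A.not_isAnchor_complexPart_of_isotropic_of_splitMono π hD B₃ hc₃ hB₃ hanch₃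

/-- The connected, totally epimorphic case of Example 3.3 is recovered (= `ArchFrd.prop35iv_C/_A`).
[cite: MochizukiFrdII2008, Prop 3.5 (iv) p.34] -/
theorem prop35iv_C_and_A_of_isTotallyEpimorphic' (hDc : IsGraphConnected D) (hTE : IsTotallyEpimorphic D) :
    Literature.AlgebraicGeometry.Frobenioids.ArchFrd.Prop35iv_C π ∧
      Literature.AlgebraicGeometry.Frobenioids.ArchFrd.Prop35iv_A π := by
  haveI : Nonempty D := hDc.nonempty
  exact ⟨prop35iv_C_of_splitMono π (splitMono_isIso_of_isTotallyEpimorphic hTE),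
    prop35iv_A_of_splitMono π (splitMono_isIso_of_isTotallyEpimorphic hTE)⟩

end ArchFrd

end

end Literature.AlgebraicGeometry.Frobenioids
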